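import Summits.QuantumFields.YangMills.Theorems.BalabanLadderUVSeamRecCeilingsFarUVTransfer
import Summits.QuantumFields.YangMills.Theorems.BalabanLadderUVSeamRecCeilingsLevelZeroLaw
import HarnessLib

/-!
# Crux `UVSeamRec` (stmt-QuantumFields-20043), v5(α) stub `stub_responseMomentsOdd6` (RM), lane B: the two combinatorial engines of the far-UV
# window cell laws — a UNION BOUND OVER WITNESSES and the THINNING of window families to conflict-free subfamilies

Helper file (`--supports stmt-QuantumFields-20043`) of the width-lever seat `ym-20043-ceilings-p2` (lane B, gen 4); sits between
`…CeilingsFarUVTransfer` (p559956: a level-`k` large field is carried by a fine plaquette within `ρ_k = (8b+2)Σ_{l<k} b^l + 1` of the block) and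
`…CeilingsFarUVWindowCellLaws` (the window cell laws inhabited in the far ultraviolet).

* §1 `prod_indicator_le_sum_pi_prod`, **`torusE_prod_indicator_le_of_witnesses`** — if every event `E_γ` (`γ ∈ A`) is covered by at most `n`
  measurable witness events `E⁰_w`, `w ∈ W γ`, and every transversal `f ∈ A.pi W` obeys `⟨∏_γ 1_{E⁰_{f γ}}∘lift⟩ ≤ δ^{#A}`, then
  `⟨∏_{γ∈A} 1_{E_γ}∘lift⟩_{2L+1,β} ≤ (nδ)^{#A}` (`Finset.prod_sum` pointwise, linearity of the torus expectation).
* §2 `exists_colourClass` (pigeonhole), `witnessRadius_bounds` (`2ρ_k+1 ≤ 19b^k`, `ρ_k ≤ 9b^k − 8` for `b ≥ 11`),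
  **`exists_conflictFree_subfamily`** — a level-`k` family whose blocks fit in one period window of the torus `2L+1` has a subfamily `A′` with
  `#A ≤ 16²·19⁴·#A′` (nonempty if `A` is) such that distinct members have, in some coordinate, NO two integers within `ρ_k` of their anchors
  congruent mod `2L+1` (colour by orientation, `y mod 19`, half-window bits when `2ρ_k ≤ L`; one member when `L < 2ρ_k`, where the window holds
  `≤ 16·35⁴` block-plaquettes).
HONEST FRAMING: combinatorics and bookkeeping only; nothing of E0′; not a gap, not Clay.  References: folklore.
-/

set_option autoImplicit false

noncomputable section

open MeasureTheory Filter Topology Finset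
open Literature.Probability.LatticeModels
open Literature.MathematicalPhysics.QuantumFieldTheory (GaugeConfig wilsonMeasure isProbabilityMeasure_wilsonMeasure
  measurable_torusLift LatticeRep)
open Literature.MathematicalPhysics.QuantumLattice

namespace Summit.QuantumFields.YangMills.Cruxes.UVSeamRec.PolymerRarity

open Summit.QuantumFields.YangMills.Cruxes.OSLegsFromFemtoAndGap.DlrCollarTransfer
open Summit.QuantumFields.YangMills.Cruxes.UVSeamRec.PolymerData
open Summit.QuantumFields.YangMills.Theorems.OddTorusChessboard (Orient)

/-! ## §1 The abstract union bound over witnesses -/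

section UnionBound

variable {G : Type} [Group G] [TopologicalSpace G] [IsTopologicalGroup G] [CompactSpace G]
  [MeasurableSpace G] [BorelSpace G] (r : LatticeRep G)

/-- **POINTWISE EXPANSION OVER WITNESSES**: if every event `E_γ` (`γ ∈ A`) is covered by the witness events `E⁰_w`, `w ∈ W γ`, then
`∏_{γ∈A} 1_{E_γ} ≤ Σ_{f ∈ A.pi W} ∏_{γ∈A} 1_{E⁰_{f γ}}` pointwise (expand `∏_γ Σ_{w∈W γ} 1_{E⁰_w}` by `Finset.prod_sum`). [folklore] -/
theorem prod_indicator_le_sum_pi_prod {Ω κ : Type} [DecidableEq κ] (A : Finset κ) (E : κ → Set Ω) (W : κ → Finset Polymer)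
    (E0 : Polymer → Set Ω) (hcover : ∀ γ ∈ A, ∀ η, η ∈ E γ → ∃ w ∈ W γ, η ∈ E0 w) (η : Ω) :
    ∏ γ ∈ A, (E γ).indicator (fun _ => (1 : ℝ)) η ≤
      ∑ f ∈ A.pi W, ∏ γ ∈ A.attach, (E0 (f γ.1 γ.2)).indicator (fun _ => (1 : ℝ)) η := by
  classical
  rw [← Finset.prod_sum A W fun γ w => (E0 w).indicator (fun _ => (1 : ℝ)) η]
  refine Finset.prod_le_prod (fun γ _ => Set.indicator_nonneg (fun _ _ => zero_le_one) _) fun γ hγ => ?_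
  by_cases hη : η ∈ E γ
  · obtain ⟨w, hw, hηw⟩ := hcover γ hγ η hη
    rw [Set.indicator_of_mem hη]
    calc (1 : ℝ) = (E0 w).indicator (fun _ => (1 : ℝ)) η := by rw [Set.indicator_of_mem hηw]
      _ ≤ ∑ w' ∈ W γ, (E0 w').indicator (fun _ => (1 : ℝ)) η :=
          Finset.single_le_sum (fun w' _ => Set.indicator_nonneg (fun _ _ => zero_le_one) _) hw
  · rw [Set.indicator_of_notMem hη]
    exact Finset.sum_nonneg fun w _ => Set.indicator_nonneg (fun _ _ => zero_le_one) _

/-- **THE UNION BOUND OVER WITNESSES, INTEGRATED**: if every `E_γ` (`γ ∈ A`, measurable) is covered by at most `n` measurable witness events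
`E⁰_w`, `w ∈ W γ` (the `E_γ` need not be measurable), and every transversal `f ∈ A.pi W` obeys `⟨∏_{γ∈A} 1_{E⁰_{f γ}}∘lift⟩ ≤ δ^{#A}` (`δ ≥ 0`), then
`⟨∏_{γ∈A} 1_{E_γ}∘lift⟩_{2L+1,β} ≤ (n·δ)^{#A}`. [folklore] -/
theorem torusE_prod_indicator_le_of_witnesses (β : ℝ) (L : ℕ) {κ : Type} [DecidableEq κ] (A : Finset κ)
    (E : κ → Set (LGConfig 4 G)) (W : κ → Finset Polymer)
    (E0 : Polymer → Set (LGConfig 4 G)) (hE0 : ∀ w, MeasurableSet (E0 w)) (n : ℕ) (hWn : ∀ γ ∈ A, (W γ).card ≤ n)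
    (hcover : ∀ γ ∈ A, ∀ η, η ∈ E γ → ∃ w ∈ W γ, η ∈ E0 w) (δ : ℝ) (hδ : 0 ≤ δ)
    (hlaw : ∀ f ∈ A.pi W, torusE G r β L (fun U => ∏ γ ∈ A.attach, (E0 (f γ.1 γ.2)).indicator (fun _ => (1 : ℝ)) U) ≤ δ ^ A.card) :
    torusE G r β L (fun U => ∏ γ ∈ A, (E γ).indicator (fun _ => (1 : ℝ)) U) ≤ ((n : ℝ) * δ) ^ A.card := by
  classical
  haveI := isProbabilityMeasure_wilsonMeasure (d := 4) (L := 2 * L + 1) r.ρ r.continuous β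
  set μT := wilsonMeasure (d := 4) (L := 2 * L + 1) r.ρ β with hμT
  have hχ0 : ∀ (S : Set (LGConfig 4 G)) (η : LGConfig 4 G), 0 ≤ S.indicator (fun _ => (1 : ℝ)) η := fun S η =>
    Set.indicator_nonneg (fun _ _ => zero_le_one) _
  have hχ1 : ∀ (S : Set (LGConfig 4 G)) (η : LGConfig 4 G), S.indicator (fun _ => (1 : ℝ)) η ≤ 1 := fun S η =>
    Set.indicator_apply_le' (fun _ => le_rfl) (fun _ => zero_le_one)
  -- the witness terms: measurable, bounded by `1`, integrable
  have hmeasf : ∀ f : (a : κ) → a ∈ A → Polymer, Measurable fun U : GaugeConfig 4 (2 * L + 1) G =>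
      ∏ γ ∈ A.attach, (E0 (f γ.1 γ.2)).indicator (fun _ => (1 : ℝ)) (torusLift (2 * L + 1) U) := fun f =>
    Finset.measurable_prod _ fun γ _ => (measurable_const.indicator (hE0 _)).comp (measurable_torusLift _)
  have hintf : ∀ f : (a : κ) → a ∈ A → Polymer, Integrable (fun U : GaugeConfig 4 (2 * L + 1) G =>
      ∏ γ ∈ A.attach, (E0 (f γ.1 γ.2)).indicator (fun _ => (1 : ℝ)) (torusLift (2 * L + 1) U)) μT := fun f => by
    refine integrable_of_abs_le (hmeasf f) (C := 1) fun U => ?_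
    rw [abs_of_nonneg (Finset.prod_nonneg fun γ _ => hχ0 _ _)]
    exact Finset.prod_le_one (fun γ _ => hχ0 _ _) fun γ _ => hχ1 _ _
  -- pointwise expansion, then integrate
  have hpt : ∀ U : GaugeConfig 4 (2 * L + 1) G,
      ∏ γ ∈ A, (E γ).indicator (fun _ => (1 : ℝ)) (torusLift (2 * L + 1) U) ≤
        ∑ f ∈ A.pi W, ∏ γ ∈ A.attach, (E0 (f γ.1 γ.2)).indicator (fun _ => (1 : ℝ)) (torusLift (2 * L + 1) U) := fun U =>
    prod_indicator_le_sum_pi_prod A E W E0 hcover _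
  have step1 : torusE G r β L (fun U => ∏ γ ∈ A, (E γ).indicator (fun _ => (1 : ℝ)) U) ≤
      ∑ f ∈ A.pi W, torusE G r β L (fun U => ∏ γ ∈ A.attach, (E0 (f γ.1 γ.2)).indicator (fun _ => (1 : ℝ)) U) := by
    unfold torusE
    rw [← integral_finsetSum _ fun f _ => hintf f]
    exact integral_mono_of_nonneg (ae_of_all _ fun U => Finset.prod_nonneg fun γ _ => hχ0 _ _)
      (integrable_finsetSum _ fun f _ => hintf f) (ae_of_all _ hpt)
  refine step1.trans ?_
  calc ∑ f ∈ A.pi W, torusE G r β L (fun U => ∏ γ ∈ A.attach, (E0 (f γ.1 γ.2)).indicator (fun _ => (1 : ℝ)) U)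
      ≤ ∑ _f ∈ A.pi W, δ ^ A.card := Finset.sum_le_sum hlaw
    _ = ((A.pi W).card : ℝ) * δ ^ A.card := by rw [Finset.sum_const, nsmul_eq_mul]
    _ ≤ ((n : ℝ) ^ A.card) * δ ^ A.card := by
        refine mul_le_mul_of_nonneg_right ?_ (pow_nonneg hδ _)
        rw [Finset.card_pi]
        exact_mod_cast Finset.prod_le_pow_card A (fun γ => (W γ).card) n hWn
    _ = ((n : ℝ) * δ) ^ A.card := by rw [mul_pow]

end UnionBound

/-! ## §2 Thinning a window family to a conflict-free subfamily -/

section Thinning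

/-- Pigeonhole over a finite nonempty palette: some colour class carries at least a `1/#colours` fraction of a finite family. [folklore] -/
theorem exists_colourClass {α κ : Type} [Fintype κ] [DecidableEq κ] [Nonempty κ] (A : Finset α) (col : α → κ) :
    ∃ c : κ, A.card ≤ Fintype.card κ * (A.filter (fun a => col a = c)).card := by
  classical
  by_contra hcon
  push Not at hcon
  have hsum : ∑ c : κ, (A.filter (fun a => col a = c)).card = A.card :=
    (Finset.card_eq_sum_card_fiberwise (f := col) (s := A) (t := Finset.univ) fun a _ => Finset.mem_univ _).symm
  have hlt : ∑ c : κ, Fintype.card κ * (A.filter (fun a => col a = c)).card < ∑ _c : κ, A.card :=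
    Finset.sum_lt_sum_of_nonempty Finset.univ_nonempty fun c _ => hcon c
  rw [← Finset.mul_sum, hsum, Finset.sum_const, smul_eq_mul, Finset.card_univ] at hlt
  exact lt_irrefl _ hlt

/-- Two polymers with the same level, block index and orientation are equal. [folklore] -/
theorem Polymer.eq_of_fields {γ₁ γ₂ : Polymer} (hk : γ₁.k = γ₂.k) (hy : γ₁.y = γ₂.y) (hμ : γ₁.μ = γ₂.μ) (hν : γ₁.ν = γ₂.ν) :
    γ₁ = γ₂ := by
  obtain ⟨k, y, μ, ν, h⟩ := γ₁
  obtain ⟨k', y', μ', ν', h'⟩ := γ₂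
  simp only at hk hy hμ hν
  subst hk hy hμ hν
  rfl

/-- A nonzero multiple of `2L+1` has absolute value `≥ 2L+1`; so an integer `X` with `0 < |X| ≤ 2L` is not `≡ 0 (mod 2L+1)`. [folklore] -/
theorem intCast_ne_intCast_of_abs_sub {M : ℕ} {u v : ℤ} (h0 : u ≠ v) (h1 : |v - u| < (M : ℤ)) :
    ((u : ℤ) : ZMod M) ≠ ((v : ℤ) : ZMod M) := by
  intro heq
  rw [ZMod.intCast_eq_intCast_iff_dvd_sub] at heq
  obtain ⟨m, hm⟩ := heq
  rcases lt_trichotomy m 0 with hm0 | hm0 | hm0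
  · have : v - u ≤ -(M : ℤ) := by rw [hm]; nlinarith
    linarith [neg_abs_le (v - u)]
  · subst hm0; simp only [mul_zero, sub_eq_zero] at hm; exact h0 hm.symm
  · have : (M : ℤ) ≤ v - u := by rw [hm]; nlinarith
    linarith [le_abs_self (v - u)]

/-- **ARITHMETIC OF THE WITNESS HALF-WIDTH** `ρ_k = (8b+2)Σ_{l<k} b^l + 1` (`b ≥ 11`): `2ρ_k + 1 ≤ 19·b^k` and `ρ_k ≤ 9·b^k − 8`. [folklore] -/
theorem witnessRadius_bounds (𝔟 : BlockSize) (hb : 11 ≤ 𝔟.b) (k : ℕ) :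
    2 * ((((8 * 𝔟.b + 2) * ∑ l ∈ Finset.range k, 𝔟.b ^ l : ℕ) : ℤ) + 1) + 1 ≤ 19 * (𝔟.b : ℤ) ^ k ∧
      (((8 * 𝔟.b + 2) * ∑ l ∈ Finset.range k, 𝔟.b ^ l : ℕ) : ℤ) + 1 ≤ 9 * (𝔟.b : ℤ) ^ k - 8 := by
  set S : ℤ := ((∑ l ∈ Finset.range k, 𝔟.b ^ l : ℕ) : ℤ) with hSdef
  have hS0 : 0 ≤ S := by rw [hSdef]; positivity
  have hgeom : ((𝔟.b : ℤ) - 1) * S + 1 = (𝔟.b : ℤ) ^ k := geomSum_intCast 𝔟.b k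
  have hb' : (11 : ℤ) ≤ 𝔟.b := by exact_mod_cast hb
  have hR : (((8 * 𝔟.b + 2) * ∑ l ∈ Finset.range k, 𝔟.b ^ l : ℕ) : ℤ) = (8 * (𝔟.b : ℤ) + 2) * S := by
    rw [hSdef]; push_cast; ring
  rw [hR, ← hgeom]
  have h1 : 0 ≤ ((𝔟.b : ℤ) - 11) * S := mul_nonneg (by linarith) hS0
  constructor <;> nlinarith

/-- **THINNING A WINDOW FAMILY.**  Block size `b ≥ 11`, level `k`, torus side `2L+1`: every finite family `A` of level-`k` block-plaquettes whose
blocks fit in one period window (`o ≤ b^k y`, `b^k y + b^k ≤ o + 2L+1`) contains a subfamily `A′` with `#A ≤ 16²·19⁴·#A′` (nonempty if `A`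
is) that is CONFLICT-FREE at the witness radius `ρ_k = (8b+2)Σ_{l<k} b^l + 1`: for distinct `γ₁, γ₂ ∈ A′` there is a coordinate `i` in which no
two integers within `ρ_k` of the anchors `b^k y₁`, `b^k y₂` are congruent mod `2L+1`.  (Colour by orientation, `y mod 19` and the half-window
bits and keep the largest class when `2ρ_k ≤ L`; keep one member when `L < 2ρ_k`, where the window holds at most `35⁴` blocks.) [folklore] -/
theorem exists_conflictFree_subfamily (𝔟 : BlockSize) (hb : 11 ≤ 𝔟.b) (k L : ℕ) (o : Fin 4 → ℤ) (A : Finset Polymer)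
    (hA : ∀ γ ∈ A, γ.k = k)
    (hwin : ∀ γ ∈ A, ∀ c, o c ≤ anchor 𝔟 γ c ∧ anchor 𝔟 γ c + (𝔟.b : ℤ) ^ k ≤ o c + (2 * L + 1)) :
    ∃ A' : Finset Polymer, A' ⊆ A ∧ (A.Nonempty → A'.Nonempty) ∧ A.card ≤ 33362176 * A'.card ∧
      ∀ γ₁ ∈ A', ∀ γ₂ ∈ A', γ₁ ≠ γ₂ → ∃ i : Fin 4, ∀ e₁ e₂ : ℤ,
        |e₁| ≤ (((8 * 𝔟.b + 2) * ∑ l ∈ Finset.range k, 𝔟.b ^ l : ℕ) : ℤ) + 1 →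
        |e₂| ≤ (((8 * 𝔟.b + 2) * ∑ l ∈ Finset.range k, 𝔟.b ^ l : ℕ) : ℤ) + 1 →
        (((𝔟.b : ℤ) ^ k * γ₁.y i + e₁ : ℤ) : ZMod (2 * L + 1)) ≠ (((𝔟.b : ℤ) ^ k * γ₂.y i + e₂ : ℤ) : ZMod (2 * L + 1)) := by
  classical
  set ρ : ℤ := (((8 * 𝔟.b + 2) * ∑ l ∈ Finset.range k, 𝔟.b ^ l : ℕ) : ℤ) + 1 with hρdef
  obtain ⟨hρ1, hρ2⟩ := witnessRadius_bounds 𝔟 hb k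
  have hρ0 : 0 ≤ ρ := by rw [hρdef]; positivity
  have hbk1 : (1 : ℤ) ≤ (𝔟.b : ℤ) ^ k := 𝔟.one_le_pow k
  -- anchors of the family
  have hanch : ∀ γ ∈ A, ∀ c, anchor 𝔟 γ c = (𝔟.b : ℤ) ^ k * γ.y c := fun γ hγ c => by rw [anchor, hA γ hγ]
  by_cases hAne : A.Nonempty
  swap
  · refine ⟨∅, Finset.empty_subset _, fun h => absurd h hAne, ?_, fun γ₁ h => absurd h (Finset.notMem_empty _)⟩
    rw [Finset.not_nonempty_iff_eq_empty.1 hAne]; simp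
  obtain ⟨γ₀, hγ₀⟩ := hAne
  by_cases hreg : 2 * ρ ≤ (L : ℤ)
  · -- REGIME 1: colour classes are conflict-free
    let col : Polymer → Orient 4 × (Fin 4 → ZMod 19) × (Fin 4 → Bool) := fun γ =>
      (⟨(γ.μ, γ.ν), γ.hμν⟩, fun i => ((γ.y i : ℤ) : ZMod 19), fun i => decide ((𝔟.b : ℤ) ^ k * γ.y i - o i ≤ (L : ℤ)))
    haveI : Nonempty (Orient 4 × (Fin 4 → ZMod 19) × (Fin 4 → Bool)) := ⟨(⟨((0 : Fin 4), (1 : Fin 4)), by decide⟩, 0, fun _ => false)⟩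
    have hcard : Fintype.card (Orient 4 × (Fin 4 → ZMod 19) × (Fin 4 → Bool)) ≤ 33362176 := by
      have h1 : Fintype.card (Orient 4) ≤ 16 := (Fintype.card_subtype_le _).trans (by simp)
      simp only [Fintype.card_prod, Fintype.card_pi, Finset.prod_const, Finset.card_univ, ZMod.card, Fintype.card_bool,
        Fintype.card_fin]
      nlinarith
    obtain ⟨c₀, hc₀⟩ := exists_colourClass A col
    refine ⟨A.filter (fun γ => col γ = c₀), Finset.filter_subset _ _, fun _ => ?_, ?_, ?_⟩
    · rw [← Finset.card_pos]
      have : 0 < A.card := Finset.card_pos.2 ⟨γ₀, hγ₀⟩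
      nlinarith
    · exact hc₀.trans (Nat.mul_le_mul_right _ hcard)
    · intro γ₁ hγ₁ γ₂ hγ₂ hne
      rw [Finset.mem_filter] at hγ₁ hγ₂
      have hcol : col γ₁ = col γ₂ := hγ₁.2.trans hγ₂.2.symm
      simp only [col, Prod.mk.injEq, Subtype.mk.injEq] at hcol
      obtain ⟨hor, hres, hbit⟩ := hcol
      -- distinct members of one class have different block indices
      have hy : γ₁.y ≠ γ₂.y := by
        intro hyy
        exact hne (Polymer.eq_of_fields ((hA γ₁ hγ₁.1).trans (hA γ₂ hγ₂.1).symm) hyy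
          hor.1 hor.2)
      obtain ⟨i, hi⟩ := Function.ne_iff.1 hy
      refine ⟨i, fun e₁ e₂ he₁ he₂ => ?_⟩
      -- same residue mod 19 ⇒ the anchors are ≥ 19 b^k apart in coordinate `i`
      have hres_i : ((γ₁.y i : ℤ) : ZMod 19) = ((γ₂.y i : ℤ) : ZMod 19) := congrFun hres i
      rw [ZMod.intCast_eq_intCast_iff_dvd_sub] at hres_i
      obtain ⟨q, hq⟩ := hres_i
      have hq0 : q ≠ 0 := by rintro rfl; simp only [mul_zero, sub_eq_zero] at hq; exact hi hq.symm
      have hfar : 19 * (𝔟.b : ℤ) ^ k ≤ |(𝔟.b : ℤ) ^ k * γ₂.y i - (𝔟.b : ℤ) ^ k * γ₁.y i| := by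
        rw [← mul_sub, hq, abs_mul, abs_mul, abs_of_nonneg (by linarith : (0 : ℤ) ≤ (𝔟.b : ℤ) ^ k)]
        have : (1 : ℤ) ≤ |q| := Int.one_le_abs hq0
        push_cast
        rw [abs_of_nonneg (by norm_num : (0 : ℤ) ≤ 19)]
        nlinarith
      -- same half-window bit ⇒ the anchors are ≤ L apart
      have hbit_i := congrFun hbit i
      simp only [decide_eq_decide] at hbit_i
      obtain ⟨hw1a, hw1b⟩ := hwin γ₁ hγ₁.1 i
      obtain ⟨hw2a, hw2b⟩ := hwin γ₂ hγ₂.1 i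
      rw [hanch γ₁ hγ₁.1] at hw1a hw1b
      rw [hanch γ₂ hγ₂.1] at hw2a hw2b
      have hnear : |(𝔟.b : ℤ) ^ k * γ₂.y i - (𝔟.b : ℤ) ^ k * γ₁.y i| ≤ L := by
        rw [abs_le]
        by_cases h1 : (𝔟.b : ℤ) ^ k * γ₁.y i - o i ≤ (L : ℤ)
        · have h2 := hbit_i.1 h1
          constructor <;> linarith
        · have h2 : ¬ ((𝔟.b : ℤ) ^ k * γ₂.y i - o i ≤ (L : ℤ)) := fun h => h1 (hbit_i.2 h)
          push Not at h1 h2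
          constructor <;> linarith
      -- so no two witnesses are congruent mod `2L+1`
      refine intCast_ne_intCast_of_abs_sub ?_ ?_
      · intro heq
        have : |(𝔟.b : ℤ) ^ k * γ₂.y i - (𝔟.b : ℤ) ^ k * γ₁.y i| ≤ 2 * ρ := by
          rw [show (𝔟.b : ℤ) ^ k * γ₂.y i - (𝔟.b : ℤ) ^ k * γ₁.y i = e₁ - e₂ by linarith]
          calc |e₁ - e₂| ≤ |e₁| + |e₂| := abs_sub _ _
            _ ≤ 2 * ρ := by linarith
        linarith
      · have htri : |(𝔟.b : ℤ) ^ k * γ₂.y i + e₂ - ((𝔟.b : ℤ) ^ k * γ₁.y i + e₁)| ≤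
            |(𝔟.b : ℤ) ^ k * γ₂.y i - (𝔟.b : ℤ) ^ k * γ₁.y i| + |e₂| + |e₁| := by
          rw [show (𝔟.b : ℤ) ^ k * γ₂.y i + e₂ - ((𝔟.b : ℤ) ^ k * γ₁.y i + e₁) =
            ((𝔟.b : ℤ) ^ k * γ₂.y i - (𝔟.b : ℤ) ^ k * γ₁.y i) + e₂ - e₁ by ring]
          calc |(𝔟.b : ℤ) ^ k * γ₂.y i - (𝔟.b : ℤ) ^ k * γ₁.y i + e₂ - e₁|
              ≤ |(𝔟.b : ℤ) ^ k * γ₂.y i - (𝔟.b : ℤ) ^ k * γ₁.y i + e₂| + |e₁| := abs_sub _ _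
            _ ≤ |(𝔟.b : ℤ) ^ k * γ₂.y i - (𝔟.b : ℤ) ^ k * γ₁.y i| + |e₂| + |e₁| := by
                linarith [abs_add_le ((𝔟.b : ℤ) ^ k * γ₂.y i - (𝔟.b : ℤ) ^ k * γ₁.y i) e₂]
        push_cast
        linarith
  · -- REGIME 2: the window holds at most `35⁴·16` block-plaquettes; keep one member
    push Not at hreg
    refine ⟨{γ₀}, Finset.singleton_subset_iff.2 hγ₀, fun _ => Finset.singleton_nonempty _, ?_, ?_⟩
    swap
    · intro γ₁ hγ₁ γ₂ hγ₂ hne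
      rw [Finset.mem_singleton] at hγ₁ hγ₂
      exact absurd (hγ₁.trans hγ₂.symm) hne
    rw [Finset.card_singleton, mul_one]
    -- pairwise the block indices differ by at most `34`
    have hdiff : ∀ γ ∈ A, ∀ γ' ∈ A, ∀ i, γ.y i - γ'.y i ≤ 34 := by
      intro γ hγ γ' hγ' i
      obtain ⟨-, h1⟩ := hwin γ hγ i
      obtain ⟨h2, -⟩ := hwin γ' hγ' i
      rw [hanch γ hγ] at h1
      rw [hanch γ' hγ'] at h2
      have h3 : (𝔟.b : ℤ) ^ k * (γ.y i - γ'.y i + 1) < (𝔟.b : ℤ) ^ k * 36 := by nlinarith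
      have h4 : γ.y i - γ'.y i + 1 < 36 := lt_of_mul_lt_mul_left h3 (by linarith)
      linarith
    -- the coordinatewise minima of the block indices
    have hne_im : ∀ i, (A.image fun γ => γ.y i).Nonempty := fun i => ⟨γ₀.y i, Finset.mem_image_of_mem _ hγ₀⟩
    set m : Fin 4 → ℤ := fun i => (A.image fun γ => γ.y i).min' (hne_im i) with hmdef
    have hm_le : ∀ γ ∈ A, ∀ i, m i ≤ γ.y i := fun γ hγ i => Finset.min'_le _ _ (Finset.mem_image_of_mem _ hγ)
    have hm_ge : ∀ γ ∈ A, ∀ i, γ.y i ≤ m i + 34 := by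
      intro γ hγ i
      obtain ⟨γ', hγ', hγ'i⟩ := Finset.mem_image.1 (Finset.min'_mem _ (hne_im i))
      have := hdiff γ hγ γ' hγ' i
      rw [hmdef]
      linarith
    -- inject `A` into a box of block indices times the orientations
    set T : Finset ((Fin 4 → ℤ) × Orient 4) :=
      (Fintype.piFinset fun i => Finset.Icc (m i) (m i + 34)) ×ˢ Finset.univ with hTdef
    have hmaps : ∀ γ ∈ A, (fun γ : Polymer => (γ.y, (⟨(γ.μ, γ.ν), γ.hμν⟩ : Orient 4))) γ ∈ T := by
      intro γ hγ
      simp only [hTdef, Finset.mem_product, Fintype.mem_piFinset, Finset.mem_Icc, Finset.mem_univ, and_true]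
      exact fun i => ⟨hm_le γ hγ i, hm_ge γ hγ i⟩
    have hinj : Set.InjOn (fun γ : Polymer => (γ.y, (⟨(γ.μ, γ.ν), γ.hμν⟩ : Orient 4))) ↑A := by
      intro γ₁ hγ₁ γ₂ hγ₂ h
      simp only [Prod.mk.injEq, Subtype.mk.injEq] at h
      exact Polymer.eq_of_fields ((hA γ₁ hγ₁).trans (hA γ₂ hγ₂).symm) h.1 h.2.1 h.2.2
    have hcardT : T.card ≤ 33362176 := by
      have h1 : Fintype.card (Orient 4) ≤ 16 := (Fintype.card_subtype_le _).trans (by simp)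
      rw [hTdef, Finset.card_product, Fintype.card_piFinset, Finset.card_univ]
      simp only [Int.card_Icc]
      have h3 : ∀ i : Fin 4, (m i + 34 + 1 - m i).toNat = 35 := fun i => by
        rw [show m i + 34 + 1 - m i = 35 by ring]; rfl
      simp only [h3, Finset.prod_const, Finset.card_univ, Fintype.card_fin]
      nlinarith
    exact (Finset.card_le_card_of_injOn _ hmaps hinj).trans hcardT

end Thinning

end Summit.QuantumFields.YangMills.Cruxes.UVSeamRec.PolymerRarity

end
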